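import Mathlib
import HarnessLib
import Summits.NavierStokesRegularity.NavierStokesRegularity.Theorems.UnthreadedDoorToroidalPotentialClosed
import Summits.NavierStokesRegularity.NavierStokesRegularity.Theorems.UnthreadedDoorToroidalPotentialSmooth

/-!
# Route UnthreadedDoor · crux `PoloidalLiouville` (stmt-NavierStokesRegularity-1222, shared with
# route ThreadingFlux) · LINE «antidynamo» v2 — stub `stub_toroidalPotential` (2a), file 3/4:
# CONSTRUCTION of the toroidal potential (centre `0`) from chord integrals in two charts

Seat ns-es-p1 g4 (director-ns KEY-NS #139 (b)), `--supports stmt-NavierStokesRegularity-1222 --as helper`;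
formalisation plan of ns-qj-p1 g3 (`TOROIDAL-POTENTIAL-PLAN.md`). Registered skeleton of record: planner
ns-idea-6 g5, `PoloidalLiouville_antidynamo_birth_v2.lean` (sha16 `4ebf5683127baf3c`), stub
`StubToroidalPotential`.

THIS FILE (`exists_toroidalPotential_zero`). For `Ω : ℝ → ℝ³ → ℝ³` jointly smooth on `(−∞,0) × ℝ³` with
sphere-tangent (`⟪y, Ω(t,y)⟫ = 0`) divergence-free slices, let `G_{t,r}(z) = ‖z‖⁻² (z × Ω(t, (r/‖z‖) z))`
(closed on `ℝ³ ∖ {0}`, file 1/4) and define, with `r = ‖x‖`, `N_r = r e₃`, `E_r = r e₁`,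
  `T(t, x) = ∫₀¹ ⟪G_{t,r}(N_r + s(x − N_r)), x − N_r⟫ ds`                    on `{x₀ ≠ 0 ∨ x₁ ≠ 0 ∨ x₂ > 0}`,
  `T(t, x) = ∫_{[N_r, E_r]} G_{t,r} + ∫_{[E_r, x]} G_{t,r}`                     on `{x₂ < 0}`,
and `T(t, 0) = 0`. Every chord used avoids the origin (`pole_chord_ne_zero`, `pole_equator_chord_ne_zero`,
`equator_chord_ne_zero`); both formulas equal `Φ(x) − Φ(N_r)` for any primitive `Φ` of `G_{t,r}`
(`integral_inner_chord_eq_sub`, file 1/4), so they agree on the overlap. Conclusions: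
* `T` is `C^∞` on `(−∞,0) × (ℝ³ ∖ {0})` (chart formulas are smooth in `(t, r, x)` by
  `contDiffOn_chordIntegral`, file 2/4, composed with `x ↦ ‖x‖`);
* `∇T(t)(x) = a x + G_{t,‖x‖}(x) = a x + ‖x‖⁻² (x × Ω(t,x))` for some real `a` (chain rule
  `hasFDerivAt_comp_norm_self`: the slice `y ↦ Φ(y) − Φ(N_r)` has gradient `G_{t,r}`, the radial
  derivative is along `x`), whence `∇T × x = Ω` in file 4/4;
* on each sphere `T(t, ·) = Φ − Φ(N_r)` — used in file 4/4 for the bound `|T| ≤ πK` along great circles.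

HONEST FRAMING: kinematics of a HYPOTHETICAL bounded ancient solution's vorticity; one stub of a line whose
wall (`stub_scalarLiouville`) is OPEN. Nothing here bears on `PoloidalLiouville`, on the UnthreadedDoor
Target, or on Navier–Stokes regularity; no summit statement is proved here.

References: G. Backus, Rev. Geophys. 24 (1986), §2; S. Chandrasekhar, Hydrodynamic and Hydromagnetic
Stability (1961), App. III (toroidal–poloidal decomposition).
-/

noncomputable section

open Set Filter Function Metric MeasureTheory intervalIntegral
open scoped Topology RealInnerProductSpace ContDiff

set_option linter.dupNamespace false

namespace Summit.NavierStokesRegularity.NavierStokesRegularity.Theorems.PoloidalLiouville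

open Literature.Analysis.FluidPDE

/-! ## Two charts of `ℝ³ ∖ {0}` and chords avoiding the origin -/

/-- Chords from the pole `r e₃` (`r > 0`) to a point off the closed negative `e₃`-ray avoid the origin.
[folklore] -/
theorem pole_chord_ne_zero {r : ℝ} (hr : 0 < r) {x : EuclideanSpace ℝ (Fin 3)}
    (hx : x 0 ≠ 0 ∨ x 1 ≠ 0 ∨ 0 < x 2) {s : ℝ} (hs : s ∈ Icc (0 : ℝ) 1) :
    r • EuclideanSpace.single (2 : Fin 3) (1 : ℝ) +
        s • (x - r • EuclideanSpace.single (2 : Fin 3) (1 : ℝ)) ≠ 0 := by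
  intro h
  have h0 := congrArg (fun z : EuclideanSpace ℝ (Fin 3) => z 0) h
  have h1 := congrArg (fun z : EuclideanSpace ℝ (Fin 3) => z 1) h
  have h2 := congrArg (fun z : EuclideanSpace ℝ (Fin 3) => z 2) h
  simp at h0 h1 h2
  rcases eq_or_lt_of_le hs.1 with hs0 | hs0
  · rw [← hs0] at h2; simp at h2; exact hr.ne' h2
  · rcases hx with hx | hx | hx
    · exact hx (by simpa [hs0.ne'] using h0)
    · exact hx (by simpa [hs0.ne'] using h1)
    · nlinarith [hs.2]

/-- The chord from the pole `r e₃` to the equator point `r e₁` (`r > 0`) avoids the origin. [folklore] -/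
theorem pole_equator_chord_ne_zero {r : ℝ} (hr : 0 < r) (s : ℝ) :
    r • EuclideanSpace.single (2 : Fin 3) (1 : ℝ) +
        s • (r • EuclideanSpace.single (0 : Fin 3) (1 : ℝ) -
          r • EuclideanSpace.single (2 : Fin 3) (1 : ℝ)) ≠ 0 := by
  intro h
  have h0 := congrArg (fun z : EuclideanSpace ℝ (Fin 3) => z 0) h
  have h2 := congrArg (fun z : EuclideanSpace ℝ (Fin 3) => z 2) h
  simp at h0 h2
  rcases h0 with h0 | h0
  · rw [h0] at h2; simp at h2; exact hr.ne' h2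
  · exact hr.ne' h0

/-- Chords from the equator point `r e₁` (`r > 0`) to a point of the open lower half-space avoid the
origin. [folklore] -/
theorem equator_chord_ne_zero {r : ℝ} (hr : 0 < r) {x : EuclideanSpace ℝ (Fin 3)} (hx : x 2 < 0)
    (s : ℝ) :
    r • EuclideanSpace.single (0 : Fin 3) (1 : ℝ) +
        s • (x - r • EuclideanSpace.single (0 : Fin 3) (1 : ℝ)) ≠ 0 := by
  intro h
  have h0 := congrArg (fun z : EuclideanSpace ℝ (Fin 3) => z 0) h
  have h2 := congrArg (fun z : EuclideanSpace ℝ (Fin 3) => z 2) h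
  simp at h0 h2
  rcases h2 with h2 | h2
  · rw [h2] at h0; simp at h0; exact hr.ne' h0
  · exact hx.ne h2

/-- A non-zero point off the chart `{x₀ ≠ 0 ∨ x₁ ≠ 0 ∨ x₂ > 0}` lies in the open lower half-space.
[folklore] -/
theorem coord_two_neg_of_not_mem {x : EuclideanSpace ℝ (Fin 3)} (hx : x ≠ 0)
    (h : ¬ (x 0 ≠ 0 ∨ x 1 ≠ 0 ∨ 0 < x 2)) : x 2 < 0 := by
  simp only [not_or, not_not, not_lt] at h
  rcases h.2.2.lt_or_eq with h2 | h2
  · exact h2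
  · exact absurd (by ext i; fin_cases i <;> simp [h.1, h.2.1, h2] : x = 0) hx

/-! ## The chain rule for `x ↦ Ψ(‖x‖, x)` -/

/-- If `Ψ : ℝ × ℝ³ → ℝ` is differentiable at `(‖x‖, x)` (`x ≠ 0`) and its slice `y ↦ Ψ(‖x‖, y)` has
gradient `g` at `x`, then `y ↦ Ψ(‖y‖, y)` has gradient `a x + g` at `x` for some real `a` (the radial
derivative divided by `‖x‖`). [folklore] -/
theorem hasFDerivAt_comp_norm_self {Ψ : ℝ × EuclideanSpace ℝ (Fin 3) → ℝ}
    {x : EuclideanSpace ℝ (Fin 3)} (hx : x ≠ 0) (hΨ : DifferentiableAt ℝ Ψ (‖x‖, x))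
    {g : EuclideanSpace ℝ (Fin 3)} (hslice : HasFDerivAt (fun y => Ψ (‖x‖, y)) (innerSL ℝ g) x) :
    ∃ a : ℝ, HasFDerivAt (fun y : EuclideanSpace ℝ (Fin 3) => Ψ (‖y‖, y)) (innerSL ℝ (a • x + g)) x := by
  set L := fderiv ℝ Ψ (‖x‖, x) with hL
  -- derivative of the norm at `x ≠ 0`
  have hn : HasFDerivAt (fun y : EuclideanSpace ℝ (Fin 3) => ‖y‖) ((‖x‖)⁻¹ • innerSL ℝ x) x := by
    have h1 : HasFDerivAt (fun y : EuclideanSpace ℝ (Fin 3) => √(‖y‖ ^ 2))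
        ((1 / (2 * √(‖x‖ ^ 2))) • (2 • innerSL ℝ x)) x :=
      (hasStrictFDerivAt_norm_sq x).hasFDerivAt.sqrt (pow_ne_zero _ (norm_ne_zero_iff.2 hx))
    have h2 : (fun y : EuclideanSpace ℝ (Fin 3) => √(‖y‖ ^ 2)) = fun y => ‖y‖ :=
      funext fun y => Real.sqrt_sq (norm_nonneg y)
    rw [h2, Real.sqrt_sq (norm_nonneg x)] at h1
    refine h1.congr_fderiv ?_
    ext y
    simp only [smul_apply, innerSL_apply_apply, smul_eq_mul, two_smul, add_apply]
    have hxn : ‖x‖ ≠ 0 := norm_ne_zero_iff.2 hx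
    field_simp
    ring
  -- slice derivative identifies `L ∘ inr`
  have hsl : HasFDerivAt (fun y => Ψ (‖x‖, y)) (L.comp (ContinuousLinearMap.inr ℝ ℝ _)) x :=
    hΨ.hasFDerivAt.comp x (hasFDerivAt_prodMk_right (‖x‖) x)
  have hinr : L.comp (ContinuousLinearMap.inr ℝ ℝ _) = innerSL ℝ g := hsl.unique hslice
  -- full chain rule
  have hc : HasFDerivAt (fun y : EuclideanSpace ℝ (Fin 3) => Ψ (‖y‖, y))
      (L.comp (((‖x‖)⁻¹ • innerSL ℝ x).prod (ContinuousLinearMap.id ℝ _))) x :=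
    HasFDerivAt.comp x (f := fun y : EuclideanSpace ℝ (Fin 3) => (‖y‖, y)) hΨ.hasFDerivAt
      (hn.prodMk (hasFDerivAt_id x))
  refine ⟨(‖x‖)⁻¹ * L (1, 0), hc.congr_fderiv ?_⟩
  ext y
  have hsplit : L ((‖x‖)⁻¹ * ⟪x, y⟫, y) = L ((‖x‖)⁻¹ * ⟪x, y⟫, 0) + L (0, y) := by
    rw [← map_add]; simp
  have h10 : L ((‖x‖)⁻¹ * ⟪x, y⟫, (0 : EuclideanSpace ℝ (Fin 3))) = ((‖x‖)⁻¹ * ⟪x, y⟫) * L (1, 0) := by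
    have : ((‖x‖)⁻¹ * ⟪x, y⟫, (0 : EuclideanSpace ℝ (Fin 3))) =
        ((‖x‖)⁻¹ * ⟪x, y⟫) • ((1 : ℝ), (0 : EuclideanSpace ℝ (Fin 3))) := by simp
    rw [this, map_smul, smul_eq_mul]
  have h0y : L (0, y) = ⟪g, y⟫ := by
    have := congrArg (fun M : EuclideanSpace ℝ (Fin 3) →L[ℝ] ℝ => M y) hinr
    simpa using this
  simp only [ContinuousLinearMap.coe_comp, comp_apply, ContinuousLinearMap.prod_apply,
    smul_apply, innerSL_apply_apply, ContinuousLinearMap.id_apply, smul_eq_mul, hsplit, h10, h0y,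
    inner_add_left, inner_smul_left, RCLike.conj_to_real]
  ring

/-! ## The toroidal potential of a sphere-tangent solenoidal field (centre `0`) -/

/-- **Construction of the toroidal potential (centre `0`).** Let `Ω : ℝ → ℝ³ → ℝ³` be jointly smooth
on `(−∞,0) × ℝ³`, with every slice `Ω(t, ·)` (`t < 0`) tangent to the spheres about the origin and
divergence free. Then there is `T : ℝ → ℝ³ → ℝ`, jointly smooth on `(−∞,0) × (ℝ³ ∖ {0})`, `T(t, 0) = 0`,
whose slices have gradient `∇T(t)(x) = a x + ‖x‖⁻² (x × Ω(t, x))` (`x ≠ 0`, some real `a`), and which on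
each sphere `‖x‖ = r` is a primitive `Φ` of the closed pull-back form `G_{t,r}` normalised at the pole:
`T(t, x) = Φ(x) − Φ(r e₃)`. (`T` is built from chord integrals of `G_{t,‖x‖}` in the two charts
`{x₀ ≠ 0 ∨ x₁ ≠ 0 ∨ x₂ > 0}` (chord from the pole) and `{x₂ < 0}` (via the equator point `r e₁`), which
agree by path independence.) [folklore] -/
theorem exists_toroidalPotential_zero
    {Ω : ℝ → EuclideanSpace ℝ (Fin 3) → EuclideanSpace ℝ (Fin 3)}
    (hΩ : ContDiffOn ℝ ∞ (uncurry Ω) (Iio 0 ×ˢ univ))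
    (htan : ∀ t < 0, ∀ y, ⟪y, Ω t y⟫ = 0)
    (hdiv : ∀ t < 0, ∀ p : EuclideanSpace ℝ (Fin 3), p ≠ 0 →
      ∑ i, fderiv ℝ (Ω t) p (EuclideanSpace.single i 1) i = 0) :
    ∃ T : ℝ → EuclideanSpace ℝ (Fin 3) → ℝ,
      ContDiffOn ℝ ∞ (uncurry T) (Iio 0 ×ˢ {0}ᶜ) ∧
      (∀ t, T t 0 = 0) ∧
      (∀ t < 0, ∀ x : EuclideanSpace ℝ (Fin 3), x ≠ 0 → ∃ a : ℝ,
        HasFDerivAt (T t) (innerSL ℝ (a • x + (‖x‖ ^ 2)⁻¹ • cross x (Ω t x))) x) ∧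
      (∀ t < 0, ∀ r : ℝ, 0 < r → ∃ Φ : EuclideanSpace ℝ (Fin 3) → ℝ,
        (∀ z : EuclideanSpace ℝ (Fin 3), z ≠ 0 →
          HasFDerivAt Φ (innerSL ℝ ((‖z‖ ^ 2)⁻¹ • cross z (Ω t ((r / ‖z‖) • z)))) z) ∧
        ∀ x : EuclideanSpace ℝ (Fin 3), x ≠ 0 → ‖x‖ = r →
          T t x = Φ x - Φ (r • EuclideanSpace.single 2 1)) := by
  classical
  set e₃ : EuclideanSpace ℝ (Fin 3) := EuclideanSpace.single 2 1 with he₃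
  set e₁ : EuclideanSpace ℝ (Fin 3) := EuclideanSpace.single 0 1 with he₁
  set G : ℝ → ℝ → EuclideanSpace ℝ (Fin 3) → EuclideanSpace ℝ (Fin 3) :=
    fun t r z => (‖z‖ ^ 2)⁻¹ • cross z (Ω t ((r / ‖z‖) • z)) with hG
  set C : ℝ → ℝ → EuclideanSpace ℝ (Fin 3) → EuclideanSpace ℝ (Fin 3) → ℝ :=
    fun t r p q => ∫ s in (0 : ℝ)..1, ⟪G t r (p + s • (q - p)), q - p⟫ with hC
  set Φp : ℝ → ℝ → EuclideanSpace ℝ (Fin 3) → ℝ := fun t r x => C t r (r • e₃) x with hΦp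
  set Φm : ℝ → ℝ → EuclideanSpace ℝ (Fin 3) → ℝ :=
    fun t r x => C t r (r • e₃) (r • e₁) + C t r (r • e₁) x with hΦm
  set Op : Set (EuclideanSpace ℝ (Fin 3)) := {x | x 0 ≠ 0 ∨ x 1 ≠ 0 ∨ 0 < x 2} with hOp
  set Tf : ℝ → ℝ → EuclideanSpace ℝ (Fin 3) → ℝ :=
    fun t r x => if x ∈ Op then Φp t r x else if x 2 < 0 then Φm t r x else 0 with hTf
  -- openness of the charts
  have hc : ∀ i : Fin 3, Continuous fun x : EuclideanSpace ℝ (Fin 3) => x i := fun i =>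
    (EuclideanSpace.proj i).continuous
  have hOp_open : IsOpen Op :=
    ((isOpen_ne.preimage (hc 0)).union ((isOpen_ne.preimage (hc 1)).union
      (isOpen_lt continuous_const (hc 2))))
  have hOm_open : IsOpen {x : EuclideanSpace ℝ (Fin 3) | x 2 < 0} := isOpen_lt (hc 2) continuous_const
  -- slices, continuity of `G`, primitives, chord identities
  have hΩ' : IsSmoothSpaceTimeOn (Iio 0) Ω := hΩ
  have hslice : ∀ t < 0, ContDiff ℝ ∞ (Ω t) := fun t ht => hΩ'.contDiff_slice ht
  have hGcont : ∀ t < 0, ∀ r, ContinuousOn (G t r) {z | z ≠ 0} := fun t ht r z hz =>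
    (contDiffAt_pullbackForm (hslice t ht) r hz).continuousAt.continuousWithinAt
  have hprim : ∀ t < 0, ∀ r : ℝ, 0 < r → ∃ Φ : EuclideanSpace ℝ (Fin 3) → ℝ,
      ∀ z : EuclideanSpace ℝ (Fin 3), z ≠ 0 → HasFDerivAt Φ (innerSL ℝ (G t r z)) z :=
    fun t ht r hr => exists_primitive_pullbackForm (hslice t ht) (htan t ht) (hdiv t ht) hr.ne'
  have hchordp : ∀ t < 0, ∀ r : ℝ, 0 < r → ∀ Φ : EuclideanSpace ℝ (Fin 3) → ℝ,
      (∀ z : EuclideanSpace ℝ (Fin 3), z ≠ 0 → HasFDerivAt Φ (innerSL ℝ (G t r z)) z) →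
      ∀ x ∈ Op, Φp t r x = Φ x - Φ (r • e₃) := fun t ht r hr Φ hΦ x hx =>
    integral_inner_chord_eq_sub (S := {z | z ≠ 0}) hΦ (hGcont t ht r)
      (fun s hs => pole_chord_ne_zero hr hx hs)
  have hchordm : ∀ t < 0, ∀ r : ℝ, 0 < r → ∀ Φ : EuclideanSpace ℝ (Fin 3) → ℝ,
      (∀ z : EuclideanSpace ℝ (Fin 3), z ≠ 0 → HasFDerivAt Φ (innerSL ℝ (G t r z)) z) →
      ∀ x : EuclideanSpace ℝ (Fin 3), x 2 < 0 → Φm t r x = Φ x - Φ (r • e₃) := by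
    intro t ht r hr Φ hΦ x hx
    have h1 : C t r (r • e₃) (r • e₁) = Φ (r • e₁) - Φ (r • e₃) :=
      integral_inner_chord_eq_sub (S := {z | z ≠ 0}) hΦ (hGcont t ht r)
        (fun s _ => pole_equator_chord_ne_zero hr s)
    have h2 : C t r (r • e₁) x = Φ x - Φ (r • e₁) :=
      integral_inner_chord_eq_sub (S := {z | z ≠ 0}) hΦ (hGcont t ht r)
        (fun s _ => equator_chord_ne_zero hr hx s)
    simp only [hΦm, h1, h2]
    ring
  have hTf_repr : ∀ t < 0, ∀ r : ℝ, 0 < r → ∀ Φ : EuclideanSpace ℝ (Fin 3) → ℝ,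
      (∀ z : EuclideanSpace ℝ (Fin 3), z ≠ 0 → HasFDerivAt Φ (innerSL ℝ (G t r z)) z) →
      ∀ x : EuclideanSpace ℝ (Fin 3), x ≠ 0 → Tf t r x = Φ x - Φ (r • e₃) := by
    intro t ht r hr Φ hΦ x hx
    by_cases hxO : x ∈ Op
    · simp only [hTf, if_pos hxO]; exact hchordp t ht r hr Φ hΦ x hxO
    · have hx2 : x 2 < 0 := coord_two_neg_of_not_mem hx hxO
      simp only [hTf, if_neg hxO, if_pos hx2]; exact hchordm t ht r hr Φ hΦ x hx2
  have hagree : ∀ t < 0, ∀ r : ℝ, 0 < r → ∀ x : EuclideanSpace ℝ (Fin 3), x 2 < 0 →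
      Tf t r x = Φm t r x := by
    intro t ht r hr x hx2
    obtain ⟨Φ, hΦ⟩ := hprim t ht r hr
    have hx : x ≠ 0 := fun h => by rw [h] at hx2; simp at hx2
    rw [hTf_repr t ht r hr Φ hΦ x hx, hchordm t ht r hr Φ hΦ x hx2]
  -- joint smoothness of the two chart formulas
  have hVp : IsOpen {q : ℝ × ℝ × EuclideanSpace ℝ (Fin 3) | q.1 < 0 ∧ 0 < q.2.1 ∧ q.2.2 ∈ Op} :=
    (isOpen_Iio.preimage continuous_fst).inter
      ((isOpen_lt continuous_const (continuous_fst.comp continuous_snd)).inter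
        (hOp_open.preimage (continuous_snd.comp continuous_snd)))
  have hVm : IsOpen {q : ℝ × ℝ × EuclideanSpace ℝ (Fin 3) | q.1 < 0 ∧ 0 < q.2.1 ∧ q.2.2 2 < 0} :=
    (isOpen_Iio.preimage continuous_fst).inter
      ((isOpen_lt continuous_const (continuous_fst.comp continuous_snd)).inter
        (hOm_open.preimage (continuous_snd.comp continuous_snd)))
  have hΦp_smooth : ContDiffOn ℝ ∞ (fun q : ℝ × ℝ × EuclideanSpace ℝ (Fin 3) => Φp q.1 q.2.1 q.2.2)
      {q | q.1 < 0 ∧ 0 < q.2.1 ∧ q.2.2 ∈ Op} :=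
    contDiffOn_chordIntegral hΩ (τ := fun q : ℝ × ℝ × EuclideanSpace ℝ (Fin 3) => q.1)
      (ρ := fun q => q.2.1) (A := fun q => q.2.1 • e₃) (B := fun q => q.2.2) contDiff_fst
      (contDiff_fst.comp contDiff_snd) ((contDiff_fst.comp contDiff_snd).smul contDiff_const)
      (contDiff_snd.comp contDiff_snd) hVp (fun q hq => hq.1)
      (fun q hq s hs => pole_chord_ne_zero hq.2.1 hq.2.2 hs)
  have hΦm_smooth : ContDiffOn ℝ ∞ (fun q : ℝ × ℝ × EuclideanSpace ℝ (Fin 3) => Φm q.1 q.2.1 q.2.2)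
      {q | q.1 < 0 ∧ 0 < q.2.1 ∧ q.2.2 2 < 0} :=
    (contDiffOn_chordIntegral hΩ (τ := fun q : ℝ × ℝ × EuclideanSpace ℝ (Fin 3) => q.1)
      (ρ := fun q => q.2.1) (A := fun q => q.2.1 • e₃) (B := fun q => q.2.1 • e₁) contDiff_fst
      (contDiff_fst.comp contDiff_snd) ((contDiff_fst.comp contDiff_snd).smul contDiff_const)
      ((contDiff_fst.comp contDiff_snd).smul contDiff_const) hVm (fun q hq => hq.1)
      (fun q hq s _ => pole_equator_chord_ne_zero hq.2.1 s)).add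
    (contDiffOn_chordIntegral hΩ (τ := fun q : ℝ × ℝ × EuclideanSpace ℝ (Fin 3) => q.1)
      (ρ := fun q => q.2.1) (A := fun q => q.2.1 • e₁) (B := fun q => q.2.2) contDiff_fst
      (contDiff_fst.comp contDiff_snd) ((contDiff_fst.comp contDiff_snd).smul contDiff_const)
      (contDiff_snd.comp contDiff_snd) hVm (fun q hq => hq.1)
      (fun q hq s _ => equator_chord_ne_zero hq.2.1 hq.2.2 s))
  -- the map `(t, x) ↦ (t, ‖x‖, x)` and `(r, y) ↦ (t, r, y)`
  have hι : ∀ q : ℝ × EuclideanSpace ℝ (Fin 3), q.2 ≠ 0 →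
      ContDiffAt ℝ ∞ (fun q : ℝ × EuclideanSpace ℝ (Fin 3) => (q.1, ‖q.2‖, q.2)) q := fun q hq =>
    contDiffAt_fst.prodMk (((contDiffAt_norm ℝ hq).comp q contDiffAt_snd).prodMk contDiffAt_snd)
  refine ⟨fun t x => Tf t ‖x‖ x, ?_, ?_, ?_, ?_⟩
  · -- joint smoothness on the punctured slab
    rintro ⟨t, x⟩ ⟨ht, hx⟩
    have ht : t < 0 := ht
    have hx : x ≠ 0 := hx
    have hxn : 0 < ‖x‖ := norm_pos_iff.2 hx
    refine ContDiffAt.contDiffWithinAt ?_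
    by_cases hxO : x ∈ Op
    · have hev : (uncurry fun t x => Tf t ‖x‖ x) =ᶠ[𝓝 (t, x)]
          fun q => (fun q' : ℝ × ℝ × EuclideanSpace ℝ (Fin 3) => Φp q'.1 q'.2.1 q'.2.2)
            (q.1, ‖q.2‖, q.2) := by
        filter_upwards [(hOp_open.preimage continuous_snd).mem_nhds (show (t, x).2 ∈ Op from hxO)]
          with q hq
        simp only [uncurry, hTf, if_pos (show q.2 ∈ Op from hq)]
      refine ContDiffAt.congr_of_eventuallyEq ?_ hev
      exact (hΦp_smooth.contDiffAt (hVp.mem_nhds ⟨ht, hxn, hxO⟩)).comp (t, x) (hι (t, x) hx)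
    · have hx2 : x 2 < 0 := coord_two_neg_of_not_mem hx hxO
      have hev : (uncurry fun t x => Tf t ‖x‖ x) =ᶠ[𝓝 (t, x)]
          fun q => (fun q' : ℝ × ℝ × EuclideanSpace ℝ (Fin 3) => Φm q'.1 q'.2.1 q'.2.2)
            (q.1, ‖q.2‖, q.2) := by
        filter_upwards [((isOpen_Iio.preimage continuous_fst).inter
          (hOm_open.preimage continuous_snd)).mem_nhds (show (t, x) ∈ _ from ⟨ht, hx2⟩)] with q hq
        have hq2 : q.2 ≠ 0 := fun h => by have := hq.2; simp [h] at this
        simp only [uncurry]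
        exact hagree q.1 hq.1 ‖q.2‖ (norm_pos_iff.2 hq2) q.2 hq.2
      refine ContDiffAt.congr_of_eventuallyEq ?_ hev
      exact (hΦm_smooth.contDiffAt (hVm.mem_nhds ⟨ht, hxn, hx2⟩)).comp (t, x) (hι (t, x) hx)
  · -- `T(t, 0) = 0`
    intro t
    have h0 : (0 : EuclideanSpace ℝ (Fin 3)) ∉ Op := by simp [hOp]
    simp only [hTf, if_neg h0]
    simp
  · -- the gradient of the slices
    intro t ht x hx
    have hxn : 0 < ‖x‖ := norm_pos_iff.2 hx
    obtain ⟨Φ, hΦ⟩ := hprim t ht ‖x‖ hxn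
    have hGx : G t ‖x‖ x = (‖x‖ ^ 2)⁻¹ • cross x (Ω t x) := by
      simp only [hG, div_self hxn.ne', one_smul]
    have hιt : ∀ q : ℝ × EuclideanSpace ℝ (Fin 3),
        ContDiffAt ℝ ∞ (fun q : ℝ × EuclideanSpace ℝ (Fin 3) => (t, q.1, q.2)) q := fun q =>
      contDiffAt_const.prodMk (contDiffAt_fst.prodMk contDiffAt_snd)
    by_cases hxO : x ∈ Op
    · -- chart of the pole chord
      have hΨ : DifferentiableAt ℝ (fun q : ℝ × EuclideanSpace ℝ (Fin 3) => Φp t q.1 q.2) (‖x‖, x) :=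
        ((hΦp_smooth.contDiffAt (hVp.mem_nhds ⟨ht, hxn, hxO⟩)).comp (‖x‖, x) (hιt _)).differentiableAt
          (by simp)
      have hsl : HasFDerivAt (fun y => Φp t ‖x‖ y) (innerSL ℝ (G t ‖x‖ x)) x := by
        refine ((hΦ x hx).sub_const (Φ (‖x‖ • e₃))).congr_of_eventuallyEq ?_
        filter_upwards [hOp_open.mem_nhds hxO] with y hy
        exact hchordp t ht ‖x‖ hxn Φ hΦ y hy
      obtain ⟨a, ha⟩ := hasFDerivAt_comp_norm_self hx hΨ hsl
      refine ⟨a, ?_⟩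
      rw [← hGx]
      refine ha.congr_of_eventuallyEq ?_
      filter_upwards [hOp_open.mem_nhds hxO] with y hy
      simp only [hTf, if_pos hy]
    · -- chart of the equator chord
      have hx2 : x 2 < 0 := coord_two_neg_of_not_mem hx hxO
      have hΨ : DifferentiableAt ℝ (fun q : ℝ × EuclideanSpace ℝ (Fin 3) => Φm t q.1 q.2) (‖x‖, x) :=
        ((hΦm_smooth.contDiffAt (hVm.mem_nhds ⟨ht, hxn, hx2⟩)).comp (‖x‖, x) (hιt _)).differentiableAt
          (by simp)
      have hsl : HasFDerivAt (fun y => Φm t ‖x‖ y) (innerSL ℝ (G t ‖x‖ x)) x := by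
        refine ((hΦ x hx).sub_const (Φ (‖x‖ • e₃))).congr_of_eventuallyEq ?_
        filter_upwards [hOm_open.mem_nhds hx2] with y hy
        exact hchordm t ht ‖x‖ hxn Φ hΦ y hy
      obtain ⟨a, ha⟩ := hasFDerivAt_comp_norm_self hx hΨ hsl
      refine ⟨a, ?_⟩
      rw [← hGx]
      refine ha.congr_of_eventuallyEq ?_
      filter_upwards [hOm_open.mem_nhds hx2] with y hy
      have hy0 : y ≠ 0 := fun h => by rw [h] at hy; simp at hy
      exact hagree t ht ‖y‖ (norm_pos_iff.2 hy0) y hy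
  · -- sphere-wise representation by a primitive normalised at the pole
    intro t ht r hr
    obtain ⟨Φ, hΦ⟩ := hprim t ht r hr
    refine ⟨Φ, hΦ, fun x hx hxr => ?_⟩
    change Tf t ‖x‖ x = _
    rw [hxr]
    exact hTf_repr t ht r hr Φ hΦ x hx

end Summit.NavierStokesRegularity.NavierStokesRegularity.Theorems.PoloidalLiouville

end
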